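import Literature.AnabelianGeometry.AbsoluteAnabelian.AbsTopIII.KummerFaithfulFunctionFieldCurveProofs
import Literature.AnabelianGeometry.AbsoluteAnabelian.AbsTopIII.KummerFaithfulFGExtensionProofs
import Literature.AnabelianGeometry.AbsoluteAnabelian.AbsTopIII.KummerFaithfulPadicProofs
import Mathlib.RingTheory.EssentialFiniteness
import HarnessLib

/-!
# [AbsTopIII] Rmk. 1.5.4 (i) at transcendence degree one: `ℚ_p(t)` and its finite extensions are Kummer-faithful

Proof-only companion (no new definitions) to `AbsTopIII/KummerFaithful.lean` (S. Mochizuki, *Topics in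
Absolute Anabelian Geometry III*, §1, Def. 1.5 p. 32, Rmk. 1.5.4 (i) p. 33, lit key
`paper:url-5493eb38cbb7`: "every sub-`p`-adic field `k` [...] is Kummer-faithful").

* `isKummerFaithful_of_finite_ratFunc_padic` — every finite extension `L` of `ℚ_p(t) = RatFunc ℚ_[p]`
  is Kummer-faithful (tree predicate: torus clause AND abelian-variety clause);
* `isKummerFaithful_ratFunc_padic` — `ℚ_p(t)` is Kummer-faithful.

The torus clause is [AbsTopIII] Rmk. 1.5.4 (ii) (`Rmk_1_5_4_ii_holds`, a finitely generated extension of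
the torally Kummer-faithful `ℚ_p`); the abelian-variety clause for the finite extensions `k'` of `L`
(again finite over `ℚ_p(t)`) is `divisibleElementsTrivial_points_of_finite_ratFunc_padic` (companion
`KummerFaithfulFunctionFieldCurveProofs`: the closed-point argument of p. 33 over the Dedekind model).
These are the first Kummer-faithful fields of POSITIVE transcendence degree over `ℚ_p` in the tree
(FACT-LIST row F-0369 `Rmk_1_5_4_i` beyond the MLF / number-field instances).  Nothing here bears on
[IUTchIII] Cor. 3.12; typed ≠ discharged.
-/

noncomputable section

open scoped Classical Polynomial

namespace Literature.AnabelianGeometry.AbsoluteAnabelian.AbsTopIII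

open Polynomial Literature.AlgebraicGeometry.Motives

/-- `ℚ_p(t)` is essentially of finite type over `ℚ_p` (a localisation of `ℚ_p[t]`). Routine.
[cite: MochizukiAbsTopIII2015, Rmk 1.5.4 (i) p.33] -/
theorem essFiniteType_ratFunc_padic (p : ℕ) [Fact p.Prime] :
    Algebra.EssFiniteType ℚ_[p] (RatFunc ℚ_[p]) := by
  haveI : Algebra.EssFiniteType ℚ_[p][X] (RatFunc ℚ_[p]) :=
    Algebra.EssFiniteType.of_isLocalization (RatFunc ℚ_[p]) (nonZeroDivisors ℚ_[p][X])
  exact Algebra.EssFiniteType.comp ℚ_[p] ℚ_[p][X] (RatFunc ℚ_[p])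

/-- **Every finite extension of `ℚ_p(t)` is Kummer-faithful** ([AbsTopIII] Rmk. 1.5.4 (i) p. 33 at
transcendence degree one, for the tree predicate `IsKummerFaithful`): torus clause by Rmk. 1.5.4 (ii)
(`Rmk_1_5_4_ii_holds` over the torally Kummer-faithful `ℚ_p`), abelian-variety clause by the
closed-point argument over the Dedekind model (`divisibleElementsTrivial_points_of_finite_ratFunc_padic`)
applied to the finite extensions `k'` of `L`, which are again finite over `ℚ_p(t)`.
[cite: MochizukiAbsTopIII2015, Rmk 1.5.4 (i) p.33] -/
theorem isKummerFaithful_of_finite_ratFunc_padic (p : ℕ) [Fact p.Prime] (L : Type) [Field L]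
    [Algebra (RatFunc ℚ_[p]) L] [FiniteDimensional (RatFunc ℚ_[p]) L] : IsKummerFaithful L := by
  -- the `ℚ_p`- and `ℚ_p[t]`-algebra structures on `L` through `ℚ_p(t)`
  letI iQL : Algebra ℚ_[p] L :=
    ((algebraMap (RatFunc ℚ_[p]) L).comp (algebraMap ℚ_[p] (RatFunc ℚ_[p]))).toAlgebra
  haveI : IsScalarTower ℚ_[p] (RatFunc ℚ_[p]) L := IsScalarTower.of_algebraMap_eq fun _ => rfl
  haveI : Algebra.EssFiniteType ℚ_[p] (RatFunc ℚ_[p]) := essFiniteType_ratFunc_padic p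
  haveI : Algebra.EssFiniteType ℚ_[p] L := Algebra.EssFiniteType.comp ℚ_[p] (RatFunc ℚ_[p]) L
  have hFG : (⊤ : IntermediateField ℚ_[p] L).FG := IntermediateField.fg_top_iff.mpr inferInstance
  refine ⟨Rmk_1_5_4_ii_holds ℚ_[p] L hFG (isTorallyKummerFaithful_padic p), fun k' _ _ hfin A => ?_⟩
  -- a finite extension `k'` of `L` is finite over `ℚ_p(t)`
  haveI := hfin
  letI iFk : Algebra (RatFunc ℚ_[p]) k' :=
    ((algebraMap L k').comp (algebraMap (RatFunc ℚ_[p]) L)).toAlgebra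
  haveI : IsScalarTower (RatFunc ℚ_[p]) L k' := IsScalarTower.of_algebraMap_eq fun _ => rfl
  haveI : FiniteDimensional (RatFunc ℚ_[p]) k' := Module.Finite.trans L k'
  letI iPk : Algebra ℚ_[p][X] k' :=
    ((algebraMap (RatFunc ℚ_[p]) k').comp (algebraMap ℚ_[p][X] (RatFunc ℚ_[p]))).toAlgebra
  haveI : IsScalarTower ℚ_[p][X] (RatFunc ℚ_[p]) k' := IsScalarTower.of_algebraMap_eq fun _ => rfl
  letI iQk : Algebra ℚ_[p] k' :=
    ((algebraMap (RatFunc ℚ_[p]) k').comp (algebraMap ℚ_[p] (RatFunc ℚ_[p]))).toAlgebra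
  haveI : IsScalarTower ℚ_[p] ℚ_[p][X] k' := IsScalarTower.of_algebraMap_eq fun c => by
    change ((algebraMap (RatFunc ℚ_[p]) k').comp (algebraMap ℚ_[p] (RatFunc ℚ_[p]))) c =
      ((algebraMap (RatFunc ℚ_[p]) k').comp (algebraMap ℚ_[p][X] (RatFunc ℚ_[p])))
        (algebraMap ℚ_[p] ℚ_[p][X] c)
    rw [RingHom.comp_apply, RingHom.comp_apply, IsScalarTower.algebraMap_apply ℚ_[p] ℚ_[p][X]
      (RatFunc ℚ_[p]) c]
  exact divisibleElementsTrivial_points_of_finite_ratFunc_padic p k' A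

/-- **`ℚ_p(t)` is Kummer-faithful** ([AbsTopIII] Rmk. 1.5.4 (i) p. 33 at the purely transcendental
extension of transcendence degree one). [cite: MochizukiAbsTopIII2015, Rmk 1.5.4 (i) p.33] -/
theorem isKummerFaithful_ratFunc_padic (p : ℕ) [Fact p.Prime] : IsKummerFaithful (RatFunc ℚ_[p]) :=
  isKummerFaithful_of_finite_ratFunc_padic p (RatFunc ℚ_[p])

end Literature.AnabelianGeometry.AbsoluteAnabelian.AbsTopIII
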